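/-
Copyright (c) 2026 the pub-hodgecm-mathlib formalisation cell (harness21).  Prover seat hodgecm-mathlib-LH4-p19 (g2), req620 Track A «(D-RAM) FOUR-FRAME» squad
(STAGE-1b, row (2) of the piece `f_{T₊}`, the (β₂) road (R-36) «PURE-CELL LEDGER»; β₂ sub-dealer LH4-p04 (g9) BETA2-BOARD v2 row (ROW-D♭), dealt by name; the (class, digit)
invariants of a lattice of the diagonal cell do not depend on the generator), 2026-09-04.
-/
import Summits.HodgeConjecture.HodgeConjecture.Theorems.F0P3cDyRamDiagonalCellCoordinates       -- ★ p862876 (this seat, K3): `eq_traceT_mul_hatw`, `map_traceTW`, `traceW_hatw`; brings ★ p862573, ★ p862758 `hatw_add_map_hatw`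
import Summits.HodgeConjecture.HodgeConjecture.Theorems.F0P3cDyRamDiagonalCellGeneratorChange   -- ★ p862877 (this seat, K5a): `exists_isOrd_mul_of_presentations`, `normTheta_orderUnit_eq`, `v_coords_mul_one_add`, `inv_add_eq_inv_mul_one_add`
import Literature.NumberTheory.LocalFields.WildQuadraticDatumNormSignConductor                 -- ★ `v_le_exp_even_of_fixed` (fixed elements have even valuation), `v_varpi_pow`
import HarnessLib

/-!
# Crux `H413`, line LH4 «(D-RAM) FOUR-FRAME» — STAGE-1b, row (2), the (β₂) road (R-36), lane B, row (ROW-D♭), THE COUNT — «THE CLASS OF `T` AND THE DIGIT OF `V` DO NOT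
# DEPEND ON THE GENERATOR»: two generators `x₀, x₀′` of one lattice `Λ = x₀·𝒪_b` of the diagonal cell give `T′ ∈ T·N_Θ(Fix ρ)` and `|V′ − V| ≤ |ϖE|^{2d}`

Cell `hodgecm-mathlib` (D-0151), FLOOR 0, crux item H413 = `stmt-HodgeConjecture-24833`, route of record `HCCMUnconditional`; squad F0∕P3c∕LH4; lane
`--supports stmt-HodgeConjecture-24833 --as helper` (count-neutral; pays NO tier-0 row).  THEOREMS ONLY (no `def`, no instance, no notation, no `sorry`, default heartbeats);
★-only imports; states NO law; (β₂) stays a HYPOTHESIS.  DATUM-FREE one-field RamK letters (`M` with `ρ`, `Θ`, `α`, `h`, a pivot `θ₀`, the ramified datum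
`IsRamifiedQuadraticDatum Θ ϖE d t` of ★ DEFS; ★ DEFS `IsOrd ∕ dualGen`); the «deep doubly fixed units are norms» letter `hdeep` is a binder (as in ★-cand K5b).

WHY (memo MECH-LDflat §2; this seat's K5b ∕ K6).  The COUNT of (ROW-D♭) fibres the diagonal cell `D = levelSet ρ Θ α ϖE h b b` by `Λ ↦ (class of T, digit of V)` read off a
generator `x₀` through `ŵ(x₀) = (ν·h·x₀Θx₀)⁻¹ = T·ŵ(V)` (★ K3).  For this to be a MAP on lattices the two invariants must not depend on the generator: a second generator is
`x₀′ = x₀·z` with `z` a unit of the order `𝒪_b` (★ K5a §1), `zΘz = aΘa + τ` with `ρa = a`, `|τ| ≤ |ϖE|^{m*}` (★ K5a §2), so `ŵ(x₀′) = ((aΘa)⁻¹T)·ŵ(V)·(1 + θ)`, `|θ| = |τ|`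
(★ K5a §4) and ★ K5a's RIGIDITY gives `T′ = (aΘa)⁻¹·T·u`, `|u − 1| ≤ |ϖE|^{m*}`, `|V′ − V| ≤ |ϖE|^{m*}`; both error terms are `Θ`-FIXED, so the parity of fixed valuations
upgrades `m* ≥ 2d − 1` to `2d` (§1), and `hdeep` makes `u` a norm `cΘc` from `Fix ρ`: `T′ = T·N_Θ(c∕a)`.
* §1 `v_le_pow_two_mul_of_fixed` (parity upgrade `|ϖE|^{m*} ⇒ |ϖE|^{2d}` for `Θ`-fixed elements), `v_eq_one_of_isOrd_of_mul_eq_one` (a unit of the order has `|z| = 1`).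
* §2 `coords_letters_of_gen` — for a generator of a lattice of `D`: `|κ| = 1`, `|ŵ| = 1`, `Θŵ = ŵ`, `|T| = 1`, `T, V` doubly fixed, `|V| ≤ 1`, `ŵ = T·ŵ(V)`.
* §3 HEAD `cls_iff_cls_and_v_sub_le_of_presentations` — generator independence of (class of `T`, digit of `V` modulo `|·| ≤ |ϖE|^{2d}`).
WHAT IS NOT CLAIMED: the fibre count (K5b), the digit balance (K6a), the assembly (K6b), the bridge to the canonical cone-ledger labels `q±`.
HONEST LABEL.  Count-neutral lattice bookkeeping; nothing printed is asserted; no census law is stated; `HC_CM` is proved only modulo the 7 printed citations (2 remaining named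
inputs: hLiu418 = `stmt-HodgeConjecture-24832`, h413 = `stmt-HodgeConjecture-24833`) until rung 0 closes.
## References
* [Serre1979] J.-P. Serre, *Local Fields*, GTM 67 (1979): Ch. III §6 Prop. 12 (orders), Ch. V §2 Prop. 3, Ch. V §3 Prop. 5 & Cor. 2–3 pp. 85–87 (fixed valuations, norms near 1).
* [Jacobowitz1962] R. Jacobowitz, *Hermitian forms over local fields*, Amer. J. Math. 84 (1962): §4 (dual lattices, gluing).
* [Kottwitz1986BaseChangeUnits] R. E. Kottwitz, *Base change for unit elements of Hecke algebras*, Compositio Math. 60 (1986): §1 pp. 240–241 (fixed-lattice counts).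
* [Flicker1998UnitaryFL] Y. Z. Flicker, *Elementary proof of the fundamental lemma for a unitary group*, Canad. J. Math. 50 (1998): Prop. 7 p. 84 (type RamK census).
-/

set_option autoImplicit false

noncomputable section

namespace Summit.HodgeConjecture.HodgeConjecture.Cruxes.H413.F0P3cDyRamDiagonalCellGeneratorIndependence

open scoped Valued WithZero
open WithZero
open Literature.NumberTheory.Automorphic.UnitaryThreeFourFrame (IsRamifiedQuadraticDatum)
open Literature.NumberTheory.LocalFields.WildQuadraticDatum (v_varpi_pow v_le_exp_even_of_fixed)
open Summit.HodgeConjecture.HodgeConjecture.Cruxes.H413.F0P3cDyRamToricCensusDefs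
open Summit.HodgeConjecture.HodgeConjecture.Cruxes.H413.F0P3cDyRamFourFramePieces (mstarOfRecord)
open Summit.HodgeConjecture.HodgeConjecture.Cruxes.H413.F0P3cDyRamDiagonalCellLetter (v_add_map_le_of_le)
open Summit.HodgeConjecture.HodgeConjecture.Cruxes.H413.F0P3cDyRamDiagonalCellScalarUnit (v_inv_add_map_inv_eq v_mul_add_map_mul_eq_one normTheta_sub_map_eq_sq_add
  v_add_map_eq_one_of_not_isOrd_div)
open Summit.HodgeConjecture.HodgeConjecture.Cruxes.H413.F0P3cDyRamDiagonalCellLiteralDigits (hatw_add_map_hatw)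
open Summit.HodgeConjecture.HodgeConjecture.Cruxes.H413.F0P3cDyRamDiagonalCellCoordinates (eq_traceT_mul_hatw map_traceTW traceW_hatw)
open Summit.HodgeConjecture.HodgeConjecture.Cruxes.H413.F0P3cDyRamDiagonalCellGeneratorChange (exists_isOrd_mul_of_presentations normTheta_orderUnit_eq
  v_coords_mul_one_add inv_add_eq_inv_mul_one_add)

variable {K : Type} [Field K] [Valued K ℤᵐ⁰] {ρ Θ : K →+* K} {α : K}

/-! ## §1 Two valuation letters -/

/-- **PARITY UPGRADE**: under the ramified datum for `Θ` (`Θ`-fixed non-zero elements have even valuation, `|ϖE| = exp(−1)`, `1 ≤ d`), a `Θ`-FIXED `x` with `|x| ≤ |ϖE|^{m*}`,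
`m* = mstarOfRecord d ≥ 2d − 1`, has `|x| ≤ |ϖE|^{2d}`. [cite: Serre1979, Ch. V §3 Prop. 5, Cor. 2–3 pp. 85–87] -/
theorem v_le_pow_two_mul_of_fixed {ϖE : K} {d t : ℕ} (hD : IsRamifiedQuadraticDatum Θ ϖE d t) {x : K} (hΘx : Θ x = x)
    (hx : Valued.v x ≤ Valued.v ϖE ^ mstarOfRecord d) : Valued.v x ≤ Valued.v ϖE ^ (2 * d) := by
  have hϖ := hD.2.2.1
  have hfix := hD.2.2.2.1
  have hd1 := hD.2.2.2.2.2.1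
  have h1 : Valued.v x ≤ exp (-(2 * ((d : ℤ) - 1) + 1)) := by
    refine hx.trans ?_
    rw [v_varpi_pow hϖ, exp_le_exp]
    unfold mstarOfRecord
    omega
  have h2 := v_le_exp_even_of_fixed hfix hΘx ((d : ℤ) - 1) h1
  rw [v_varpi_pow hϖ]
  refine h2.trans ?_
  rw [exp_le_exp]
  omega

/-- **A UNIT OF THE ORDER HAS VALUATION ONE**: `IsOrd z`, `IsOrd z′`, `z·z′ = 1` ⇒ `|z| = 1` (both are integral). [cite: Serre1979, Ch. III §6 Prop. 12] -/
theorem v_eq_one_of_isOrd_of_mul_eq_one {cc z z' : K} (hz : IsOrd ρ α cc z) (hz' : IsOrd ρ α cc z') (hzz' : z * z' = 1) : Valued.v z = 1 := by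
  have h1 : Valued.v z * Valued.v z' = 1 := by rw [← Valuation.map_mul, hzz', Valuation.map_one]
  have hz1 : Valued.v z ≤ 1 := ((isOrd_iff _ _ _ _).1 hz).1
  have hz'1 : Valued.v z' ≤ 1 := ((isOrd_iff _ _ _ _).1 hz').1
  refine le_antisymm hz1 ?_
  by_contra hlt
  rw [not_le] at hlt
  have h2 : Valued.v z * Valued.v z' < 1 :=
    calc Valued.v z * Valued.v z' ≤ Valued.v z * 1 := by gcongr
      _ < 1 := by rw [mul_one]; exact hlt
  rw [h1] at h2
  exact lt_irrefl _ h2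

/-! ## §2 The coordinate letters of a generator of a lattice of the diagonal cell -/

/-- **COORDINATE LETTERS OF A GENERATOR.**  One-field RamK letters; `x₀` with the Gram-primitivity and level clauses of `levelSet ρ Θ α ϖE h b b` (`1 ≤ b`).  With `κ = h·x₀Θx₀`,
`ν = (α − ρα)Θ(α − ρα)`, `ŵ = (ν·κ)⁻¹`, `T = ŵ + ρŵ`, `W = θ₀ŵ + ρ(θ₀ŵ)`, `V = W∕T`: `|κ| = 1`, `|ŵ| = 1`, `Θŵ = ŵ`, `|T| = 1`, `ρT = T`, `ΘT = T`, `ρV = V`, `ΘV = V`, `|V| ≤ 1`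
and `ŵ = T·ŵ(V)`, `ŵ(V) = (V − ρθ₀)∕(θ₀ − ρθ₀)`. [cite: Jacobowitz1962, §4] [cite: Serre1979, Ch. V §2 Prop. 3] -/
theorem coords_letters_of_gen (hρρ : ∀ x, ρ (ρ x) = x) (hvρ : ∀ x, Valued.v (ρ x) = Valued.v x) (hΘΘ : ∀ x, Θ (Θ x) = x)
    (hΘρ : ∀ x, Θ (ρ x) = ρ (Θ x)) (hvΘ : ∀ x, Valued.v (Θ x) = Valued.v x) (hαρ1 : Valued.v (α - ρ α) = 1) (hram : Valued.v (α - Θ α) < 1)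
    {h ϖE θ₀ : K} (hΘh : Θ h = h) (hρϖ : ρ ϖE = ϖE) (hϖE : Valued.v ϖE = exp (-1 : ℤ))
    (hΘθ₀ : Θ θ₀ = θ₀) (hθ1 : Valued.v θ₀ ≤ 1) (hθρ : Valued.v (θ₀ - ρ θ₀) = 1) {b : ℕ} (hb1 : 1 ≤ b) {x₀ : K}
    (hprim : ¬ IsOrd ρ α (ϖE ^ b) (dualGen ρ Θ α (ϖE ^ b) h x₀ / ϖE)) (hlev : Valued.v (dualGen ρ Θ α (ϖE ^ b) h x₀) = Valued.v ϖE ^ b) :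
    Valued.v (h * (x₀ * Θ x₀)) = 1 ∧ Valued.v (((α - ρ α) * Θ (α - ρ α)) * (h * (x₀ * Θ x₀)))⁻¹ = 1 ∧
      Θ (((α - ρ α) * Θ (α - ρ α)) * (h * (x₀ * Θ x₀)))⁻¹ = (((α - ρ α) * Θ (α - ρ α)) * (h * (x₀ * Θ x₀)))⁻¹ ∧
      Valued.v ((((α - ρ α) * Θ (α - ρ α)) * (h * (x₀ * Θ x₀)))⁻¹ + ρ (((α - ρ α) * Θ (α - ρ α)) * (h * (x₀ * Θ x₀)))⁻¹) = 1 ∧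
      ρ ((((α - ρ α) * Θ (α - ρ α)) * (h * (x₀ * Θ x₀)))⁻¹ + ρ (((α - ρ α) * Θ (α - ρ α)) * (h * (x₀ * Θ x₀)))⁻¹) =
        (((α - ρ α) * Θ (α - ρ α)) * (h * (x₀ * Θ x₀)))⁻¹ + ρ (((α - ρ α) * Θ (α - ρ α)) * (h * (x₀ * Θ x₀)))⁻¹ ∧
      Θ ((((α - ρ α) * Θ (α - ρ α)) * (h * (x₀ * Θ x₀)))⁻¹ + ρ (((α - ρ α) * Θ (α - ρ α)) * (h * (x₀ * Θ x₀)))⁻¹) =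
        (((α - ρ α) * Θ (α - ρ α)) * (h * (x₀ * Θ x₀)))⁻¹ + ρ (((α - ρ α) * Θ (α - ρ α)) * (h * (x₀ * Θ x₀)))⁻¹ ∧
      ρ ((θ₀ * (((α - ρ α) * Θ (α - ρ α)) * (h * (x₀ * Θ x₀)))⁻¹ + ρ (θ₀ * (((α - ρ α) * Θ (α - ρ α)) * (h * (x₀ * Θ x₀)))⁻¹)) /
          ((((α - ρ α) * Θ (α - ρ α)) * (h * (x₀ * Θ x₀)))⁻¹ + ρ (((α - ρ α) * Θ (α - ρ α)) * (h * (x₀ * Θ x₀)))⁻¹)) =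
        (θ₀ * (((α - ρ α) * Θ (α - ρ α)) * (h * (x₀ * Θ x₀)))⁻¹ + ρ (θ₀ * (((α - ρ α) * Θ (α - ρ α)) * (h * (x₀ * Θ x₀)))⁻¹)) /
          ((((α - ρ α) * Θ (α - ρ α)) * (h * (x₀ * Θ x₀)))⁻¹ + ρ (((α - ρ α) * Θ (α - ρ α)) * (h * (x₀ * Θ x₀)))⁻¹) ∧
      Θ ((θ₀ * (((α - ρ α) * Θ (α - ρ α)) * (h * (x₀ * Θ x₀)))⁻¹ + ρ (θ₀ * (((α - ρ α) * Θ (α - ρ α)) * (h * (x₀ * Θ x₀)))⁻¹)) /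
          ((((α - ρ α) * Θ (α - ρ α)) * (h * (x₀ * Θ x₀)))⁻¹ + ρ (((α - ρ α) * Θ (α - ρ α)) * (h * (x₀ * Θ x₀)))⁻¹)) =
        (θ₀ * (((α - ρ α) * Θ (α - ρ α)) * (h * (x₀ * Θ x₀)))⁻¹ + ρ (θ₀ * (((α - ρ α) * Θ (α - ρ α)) * (h * (x₀ * Θ x₀)))⁻¹)) /
          ((((α - ρ α) * Θ (α - ρ α)) * (h * (x₀ * Θ x₀)))⁻¹ + ρ (((α - ρ α) * Θ (α - ρ α)) * (h * (x₀ * Θ x₀)))⁻¹) ∧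
      Valued.v ((θ₀ * (((α - ρ α) * Θ (α - ρ α)) * (h * (x₀ * Θ x₀)))⁻¹ + ρ (θ₀ * (((α - ρ α) * Θ (α - ρ α)) * (h * (x₀ * Θ x₀)))⁻¹)) /
          ((((α - ρ α) * Θ (α - ρ α)) * (h * (x₀ * Θ x₀)))⁻¹ + ρ (((α - ρ α) * Θ (α - ρ α)) * (h * (x₀ * Θ x₀)))⁻¹)) ≤ 1 ∧
      (((α - ρ α) * Θ (α - ρ α)) * (h * (x₀ * Θ x₀)))⁻¹ =
        ((((α - ρ α) * Θ (α - ρ α)) * (h * (x₀ * Θ x₀)))⁻¹ + ρ (((α - ρ α) * Θ (α - ρ α)) * (h * (x₀ * Θ x₀)))⁻¹) *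
          (((θ₀ * (((α - ρ α) * Θ (α - ρ α)) * (h * (x₀ * Θ x₀)))⁻¹ + ρ (θ₀ * (((α - ρ α) * Θ (α - ρ α)) * (h * (x₀ * Θ x₀)))⁻¹)) /
            ((((α - ρ α) * Θ (α - ρ α)) * (h * (x₀ * Θ x₀)))⁻¹ + ρ (((α - ρ α) * Θ (α - ρ α)) * (h * (x₀ * Θ x₀)))⁻¹) - ρ θ₀) / (θ₀ - ρ θ₀)) := by
  -- letters
  have hvϖ0 : Valued.v ϖE ≠ 0 := by rw [hϖE]; exact exp_ne_zero
  have hϖ0 : ϖE ≠ 0 := fun h0 => by rw [h0, map_zero] at hvϖ0; exact hvϖ0 rfl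
  have hϖ1 : Valued.v ϖE ≤ 1 := by rw [hϖE, ← exp_zero, exp_le_exp]; norm_num
  have hθ₀ : ρ θ₀ ≠ θ₀ := fun h0 => by rw [h0, sub_self, map_zero] at hθρ; exact zero_ne_one hθρ
  set ν : K := (α - ρ α) * Θ (α - ρ α) with hν
  have hνv : Valued.v ν = 1 := by rw [hν, Valuation.map_mul, hvΘ, hαρ1, mul_one]
  have hΘν : Θ ν = ν := by rw [hν, map_mul, hΘΘ, mul_comm]
  have hα0 : α - ρ α ≠ 0 := fun h0 => by rw [h0, map_zero] at hαρ1; exact zero_ne_one hαρ1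
  have hcc : ϖE ^ b * (α - ρ α) ≠ 0 := mul_ne_zero (pow_ne_zero _ hϖ0) hα0
  have hρcc : ρ (ϖE ^ b) = ϖE ^ b := by rw [map_pow, hρϖ]
  have hccv : Valued.v (ϖE ^ b * (α - ρ α)) = Valued.v ϖE ^ b := by rw [Valuation.map_mul, Valuation.map_pow, hαρ1, mul_one]
  set κ : K := h * (x₀ * Θ x₀) with hκ
  set ŵ : K := (ν * κ)⁻¹ with hŵdef
  set T : K := ŵ + ρ ŵ with hTdef
  set W : K := θ₀ * ŵ + ρ (θ₀ * ŵ) with hWdef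
  have hY : dualGen ρ Θ α (ϖE ^ b) h x₀ = κ * (ϖE ^ b * (α - ρ α)) := by rw [dualGen_def]
  have hκv : Valued.v κ = 1 := by
    have h1 := hlev
    rw [hY, Valuation.map_mul, hccv] at h1
    exact (mul_eq_right₀ (pow_ne_zero _ hvϖ0)).1 h1
  have hΘκ : Θ κ = κ := by rw [hκ, map_mul, map_mul, hΘh, hΘΘ]; ring
  have hΘŵ : Θ ŵ = ŵ := by rw [hŵdef, map_inv₀, map_mul, hΘν, hΘκ]
  have hŵv : Valued.v ŵ = 1 := by rw [hŵdef, map_inv₀, Valuation.map_mul, hνv, hκv, one_mul, inv_one]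
  -- Gram-primitivity ⇒ `|κ + ρκ| = 1` ⇒ `|T| = 1`
  have hκtr : Valued.v (κ + ρ κ) = 1 := by
    have hY1 : Valued.v (κ * (ϖE ^ b * (α - ρ α)) / ϖE) ≤ 1 := by
      rw [map_div₀, Valuation.map_mul, hκv, one_mul, hccv, div_le_one₀ (zero_lt_iff.2 hvϖ0)]
      calc Valued.v ϖE ^ b ≤ Valued.v ϖE ^ 1 := pow_le_pow_right_of_le_one' hϖ1 hb1
        _ = _ := pow_one _
    rw [hY] at hprim
    exact v_add_map_eq_one_of_not_isOrd_div hρρ hvρ hρcc hρϖ hcc hκv.le hϖE hY1 hprim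
  have hTv : Valued.v T = 1 := by
    rw [hTdef, hŵdef, v_inv_add_map_inv_eq hvρ (by rw [Valuation.map_mul, hνv, hκv, one_mul])]
    obtain ⟨hρf₁, hf₁, hπ₁⟩ := normTheta_sub_map_eq_sq_add (Θ := Θ) hρρ hvρ hΘρ hαρ1 hram
    have hsplit : ν = (α - ρ α) * (α - ρ α) + ((α - ρ α) * Θ (α - ρ α) - (α - ρ α) * (α - ρ α)) := by rw [hν]; ring
    rw [hsplit]; exact v_mul_add_map_mul_eq_one hvρ hκv.le hκtr hρf₁ hf₁ hπ₁
  have hT0 : T ≠ 0 := fun h0 => by rw [h0, map_zero] at hTv; exact zero_ne_one hTv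
  obtain ⟨hρT, hΘT, hρW, hΘW⟩ := map_traceTW (θ₀ := θ₀) (ŵ := ŵ) hρρ hΘρ hΘθ₀ hΘŵ
  have hWv : Valued.v W ≤ 1 := by
    refine v_add_map_le_of_le ρ hvρ ?_
    rw [Valuation.map_mul, hŵv, mul_one]; exact hθ1
  refine ⟨hκv, hŵv, hΘŵ, hTv, hρT, hΘT, by rw [map_div₀, hρT, hρW], by rw [map_div₀, hΘT, hΘW], by rw [map_div₀, hTv, div_one]; exact hWv, ?_⟩
  rw [hTdef, hWdef]; exact eq_traceT_mul_hatw (ρ := ρ) hθ₀ hT0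

/-! ## §3 HEAD — the class of `T` and the digit of `V` are the same for two generators of one lattice -/

/-- **HEAD — «THE (CLASS, DIGIT) INVARIANTS DO NOT DEPEND ON THE GENERATOR».**  One-field RamK letters (`ρ`, `Θ` commuting isometric involutions, `|α − ρα| = 1`, `|α| ≤ 1`,
`|α − Θα| < 1`, `Θh = h`, `ρϖE = ϖE`, the ramified datum `IsRamifiedQuadraticDatum Θ ϖE d t`, a `Θ`-fixed pivot `θ₀` with `|θ₀| ≤ 1`, `|θ₀ − ρθ₀| = 1`), `d ≤ b`, `m* ≤ 2b`, the
letter `hdeep` («doubly fixed units `≡ 1 (ϖE^{2d})` are `Θ`-norms of `ρ`-fixed elements»); two presentations `Λ = x₀·𝒪_b = x₀′·𝒪_b` of one lattice whose `x₀` satisfies the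
Gram-primitivity and level clauses of the diagonal cell.  THEN, with `T(x) = Tr_ρ ŵ(x)`, `V(x) = Tr_ρ(θ₀ŵ(x))∕Tr_ρ ŵ(x)`, `ŵ(x) = (ν·h·xΘx)⁻¹`:
`(∃ c, ρc = c ∧ cΘc = T(x₀)) ↔ (∃ c, ρc = c ∧ cΘc = T(x₀′))` and `|V(x₀′) − V(x₀)| ≤ |ϖE|^{2d}`.  (★ K5a: `x₀′ = x₀·z`, `zΘz = aΘa + τ`, RIGIDITY; §1 parity; `hdeep`.)
[cite: Serre1979, Ch. III §6 Prop. 12; Ch. V §3 Cor. 3] [cite: Kottwitz1986BaseChangeUnits, §1 pp. 240–241] [cite: Flicker1998UnitaryFL, Prop. 7 p. 84] -/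
theorem cls_iff_cls_and_v_sub_le_of_presentations (hρρ : ∀ x, ρ (ρ x) = x) (hvρ : ∀ x, Valued.v (ρ x) = Valued.v x) (hΘΘ : ∀ x, Θ (Θ x) = x)
    (hΘρ : ∀ x, Θ (ρ x) = ρ (Θ x)) (hvΘ : ∀ x, Valued.v (Θ x) = Valued.v x) (hαρ1 : Valued.v (α - ρ α) = 1) (hα1 : Valued.v α ≤ 1)
    (hram : Valued.v (α - Θ α) < 1) {h ϖE θ₀ : K} (hΘh : Θ h = h) (hρϖ : ρ ϖE = ϖE) {d t : ℕ} (hD : IsRamifiedQuadraticDatum Θ ϖE d t)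
    (hΘθ₀ : Θ θ₀ = θ₀) (hθ1 : Valued.v θ₀ ≤ 1) (hθρ : Valued.v (θ₀ - ρ θ₀) = 1) {b : ℕ} (hdb : d ≤ b) (hmb : mstarOfRecord d ≤ 2 * b)
    (hdeep : ∀ u : K, ρ u = u → Θ u = u → Valued.v (u - 1) ≤ Valued.v ϖE ^ (2 * d) → ∃ c : K, ρ c = c ∧ c * Θ c = u)
    {Λ : AddSubgroup K} {x₀ x₀' : K} (hx₀ : x₀ ≠ 0)
    (hΛx : ∀ x, x ∈ Λ ↔ ∃ ζ, IsOrd ρ α (ϖE ^ b) ζ ∧ x = x₀ * ζ) (hΛx' : ∀ x, x ∈ Λ ↔ ∃ ζ, IsOrd ρ α (ϖE ^ b) ζ ∧ x = x₀' * ζ)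
    (hprim : ¬ IsOrd ρ α (ϖE ^ b) (dualGen ρ Θ α (ϖE ^ b) h x₀ / ϖE)) (hlev : Valued.v (dualGen ρ Θ α (ϖE ^ b) h x₀) = Valued.v ϖE ^ b) :
    ((∃ c : K, ρ c = c ∧ c * Θ c = (((α - ρ α) * Θ (α - ρ α)) * (h * (x₀ * Θ x₀)))⁻¹ + ρ (((α - ρ α) * Θ (α - ρ α)) * (h * (x₀ * Θ x₀)))⁻¹) ↔
        (∃ c : K, ρ c = c ∧ c * Θ c = (((α - ρ α) * Θ (α - ρ α)) * (h * (x₀' * Θ x₀')))⁻¹ + ρ (((α - ρ α) * Θ (α - ρ α)) * (h * (x₀' * Θ x₀')))⁻¹)) ∧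
      Valued.v ((θ₀ * (((α - ρ α) * Θ (α - ρ α)) * (h * (x₀' * Θ x₀')))⁻¹ + ρ (θ₀ * (((α - ρ α) * Θ (α - ρ α)) * (h * (x₀' * Θ x₀')))⁻¹)) /
            ((((α - ρ α) * Θ (α - ρ α)) * (h * (x₀' * Θ x₀')))⁻¹ + ρ (((α - ρ α) * Θ (α - ρ α)) * (h * (x₀' * Θ x₀')))⁻¹) -
          (θ₀ * (((α - ρ α) * Θ (α - ρ α)) * (h * (x₀ * Θ x₀)))⁻¹ + ρ (θ₀ * (((α - ρ α) * Θ (α - ρ α)) * (h * (x₀ * Θ x₀)))⁻¹)) /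
            ((((α - ρ α) * Θ (α - ρ α)) * (h * (x₀ * Θ x₀)))⁻¹ + ρ (((α - ρ α) * Θ (α - ρ α)) * (h * (x₀ * Θ x₀)))⁻¹)) ≤ Valued.v ϖE ^ (2 * d) := by
  -- letters
  have hϖE : Valued.v ϖE = exp (-1 : ℤ) := hD.2.2.1
  have hd1 : 1 ≤ d := hD.2.2.2.2.2.1
  have hb1 : 1 ≤ b := le_trans hd1 hdb
  have hϖ1 : Valued.v ϖE ≤ 1 := by rw [hϖE, ← exp_zero, exp_le_exp]; norm_num
  have hϖlt : Valued.v ϖE < 1 := by rw [hϖE, ← exp_zero, exp_lt_exp]; norm_num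
  have hm1 : 1 ≤ mstarOfRecord d := by unfold mstarOfRecord; omega
  have hr : Valued.v ϖE ^ mstarOfRecord d < 1 := pow_lt_one₀ zero_le hϖlt (by omega)
  have hθ₀ : ρ θ₀ ≠ θ₀ := fun h0 => by rw [h0, sub_self, map_zero] at hθρ; exact zero_ne_one hθρ
  have hδ : θ₀ - ρ θ₀ ≠ 0 := sub_ne_zero.2 (Ne.symm hθ₀)
  have hα : ρ α ≠ α := fun h0 => by rw [h0, sub_self, map_zero] at hαρ1; exact zero_ne_one hαρ1
  have hint : ∀ z : K, Valued.v z ≤ 1 → Valued.v ((z - ρ z) / (α - ρ α)) ≤ 1 := fun z hz => by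
    rw [map_div₀, hαρ1, div_one]; exact (Valuation.map_sub _ _ _).trans (max_le hz (by rw [hvρ]; exact hz))
  -- the old generator
  obtain ⟨hκv, hŵv, hΘŵ, hTv, hρT, hΘT, hρV, hΘV, hV1, hfact⟩ :=
    coords_letters_of_gen hρρ hvρ hΘΘ hΘρ hvΘ hαρ1 hram hΘh hρϖ hϖE hΘθ₀ hθ1 hθρ hb1 hprim hlev
  set ν : K := (α - ρ α) * Θ (α - ρ α) with hν
  set κ : K := h * (x₀ * Θ x₀) with hκ
  set ŵ : K := (ν * κ)⁻¹ with hŵdef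
  set T : K := ŵ + ρ ŵ with hTdef
  set W : K := θ₀ * ŵ + ρ (θ₀ * ŵ) with hWdef
  set V : K := W / T with hVdef
  have hT0 : T ≠ 0 := fun h0 => by rw [h0, map_zero] at hTv; exact zero_ne_one hTv
  -- the unit `z` of the order with `x₀′ = x₀·z`, and `zΘz = aΘa + τ`
  obtain ⟨z, z', hz, hz', hx₀', hzz'⟩ := exists_isOrd_mul_of_presentations hx₀ hΛx hΛx'
  have hz1 : Valued.v z = 1 := v_eq_one_of_isOrd_of_mul_eq_one hz hz' hzz'
  obtain ⟨a, τ, hρa, ha1, hΘτ, hτv, hzΘz⟩ := normTheta_orderUnit_eq hρρ hα hα1 hint hD hρϖ hdb hmb hz hz1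
  have hτlt : Valued.v τ < 1 := lt_of_le_of_lt hτv hr
  have haa1 : Valued.v (a * Θ a) = 1 := by rw [Valuation.map_mul, hvΘ, ha1, mul_one]
  have haa0 : a * Θ a ≠ 0 := fun h0 => by rw [h0, map_zero] at haa1; exact zero_ne_one haa1
  have ha0 : a ≠ 0 := fun h0 => haa0 (by rw [h0, zero_mul])
  have hΘaa : Θ (a * Θ a) = a * Θ a := by rw [map_mul, hΘΘ, mul_comm]
  have hρaa : ρ (a * Θ a) = a * Θ a := by rw [map_mul, ← hΘρ, hρa]
  obtain ⟨hinv, hθv, hΘθimp⟩ := inv_add_eq_inv_mul_one_add (Θ := Θ) hvΘ (n₀ := a * Θ a) (τ := τ) haa1 hτlt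
  set θ : K := -(τ / (a * Θ a + τ)) with hθdef
  have hΘθ : Θ θ = θ := hΘθimp hΘaa hΘτ
  have hθr : Valued.v θ ≤ Valued.v ϖE ^ mstarOfRecord d := by rw [hθv]; exact hτv
  -- `ŵ(x₀′) = ((aΘa)⁻¹·T)·ŵ(V)·(1 + θ)`
  have hŵ' : (ν * (h * (x₀' * Θ x₀')))⁻¹ = (a * Θ a)⁻¹ * T * ((V - ρ θ₀) / (θ₀ - ρ θ₀)) * (1 + θ) := by
    have e1 : h * (x₀' * Θ x₀') = κ * (z * Θ z) := by rw [hx₀', map_mul, hκ]; ring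
    calc (ν * (h * (x₀' * Θ x₀')))⁻¹ = (ν * κ)⁻¹ * (a * Θ a + τ)⁻¹ := by rw [e1, hzΘz, ← mul_assoc, mul_inv]
      _ = ŵ * ((a * Θ a)⁻¹ * (1 + θ)) := by rw [← hŵdef, hinv]
      _ = _ := by rw [hfact]; ring
  -- letters of `w₀ = ŵ(V)` and `n = (aΘa)⁻¹·T`
  have hw₀1 : Valued.v ((V - ρ θ₀) / (θ₀ - ρ θ₀)) ≤ 1 := by
    rw [map_div₀, hθρ, div_one]; exact (Valuation.map_sub _ _ _).trans (max_le hV1 (by rw [hvρ]; exact hθ1))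
  have hT₀1 : Valued.v ((V - ρ θ₀) / (θ₀ - ρ θ₀) + ρ ((V - ρ θ₀) / (θ₀ - ρ θ₀))) = 1 := by
    rw [hatw_add_map_hatw (θ₀ := θ₀) hρρ hθ₀ hρV, Valuation.map_one]
  have hρn : ρ ((a * Θ a)⁻¹ * T) = (a * Θ a)⁻¹ * T := by rw [map_mul, map_inv₀, hρaa, hρT]
  have hn1 : Valued.v ((a * Θ a)⁻¹ * T) = 1 := by rw [Valuation.map_mul, map_inv₀, haa1, hTv, inv_one, one_mul]
  -- rigidity
  obtain ⟨hT'cls, hT'1, hV'⟩ := v_coords_mul_one_add (ρ := ρ) hvρ (n := (a * Θ a)⁻¹ * T) (w₀ := (V - ρ θ₀) / (θ₀ - ρ θ₀)) (θ := θ) (θ₀ := θ₀)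
    hρn hn1 hθ1 hw₀1 hT₀1 hr hθr
  rw [hatw_add_map_hatw (θ₀ := θ₀) hρρ hθ₀ hρV, mul_one] at hT'cls
  rw [traceW_hatw (θ₀ := θ₀) hρρ hθ₀ hρV, hatw_add_map_hatw (θ₀ := θ₀) hρρ hθ₀ hρV, div_one] at hV'
  -- rewrite the goal through `ŵ(x₀′) = ŵ′`; the new `ŵ′` is `Θ`-fixed, hence so are `T′`, `W′`
  rw [hŵ']
  set ŵ' : K := (a * Θ a)⁻¹ * T * ((V - ρ θ₀) / (θ₀ - ρ θ₀)) * (1 + θ) with hŵ'def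
  have hΘŵ' : Θ ŵ' = ŵ' := by
    simp only [hŵ'def, map_mul, map_inv₀, map_div₀, map_sub, map_add, map_one, hΘΘ, hΘT, hΘV, hΘρ, hΘθ₀, hΘθ]
    ring
  obtain ⟨hρT', hΘT', hρW', hΘW'⟩ := map_traceTW (θ₀ := θ₀) (ŵ := ŵ') hρρ hΘρ hΘθ₀ hΘŵ'
  set T' : K := ŵ' + ρ ŵ' with hT'def
  set W' : K := θ₀ * ŵ' + ρ (θ₀ * ŵ') with hW'def
  have hT'0 : T' ≠ 0 := fun h0 => by rw [h0, map_zero] at hT'1; exact zero_ne_one hT'1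
  have hΘa0 : Θ a ≠ 0 := (map_ne_zero Θ).2 ha0
  refine ⟨?_, ?_⟩
  · -- the class of `T′`: `u = T′∕((aΘa)⁻¹T)` is a deep doubly fixed unit, hence `cΘc`
    set uu : K := T' / ((a * Θ a)⁻¹ * T) with huu
    have hn0 : (a * Θ a)⁻¹ * T ≠ 0 := mul_ne_zero (inv_ne_zero haa0) hT0
    have hρuu : ρ uu = uu := by rw [huu, map_div₀, hρT', hρn]
    have hΘuu : Θ uu = uu := by rw [huu, map_div₀, hΘT', map_mul, map_inv₀, hΘaa, hΘT]
    have hΘuu1 : Θ (uu - 1) = uu - 1 := by rw [map_sub, hΘuu, map_one]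
    have huu1 : Valued.v (uu - 1) ≤ Valued.v ϖE ^ (2 * d) := v_le_pow_two_mul_of_fixed hD hΘuu1 hT'cls
    obtain ⟨c, hρc, hc⟩ := hdeep uu hρuu hΘuu huu1
    have hc0 : c ≠ 0 := fun h0 => by
      have : uu = 0 := by rw [← hc, h0, zero_mul]
      rw [huu, div_eq_zero_iff] at this
      rcases this with h1 | h1
      · exact hT'0 h1
      · exact hn0 h1
    have hΘc0 : Θ c ≠ 0 := (map_ne_zero Θ).2 hc0
    have hTuu : T' = T * ((c / a) * Θ (c / a)) := by
      have e1 : T' = (a * Θ a)⁻¹ * T * uu := by rw [huu, mul_div_cancel₀ _ hn0]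
      rw [e1, ← hc, map_div₀]
      field_simp
    constructor
    · rintro ⟨c', hρc', hc'⟩
      exact ⟨c' * (c / a), by rw [map_mul, map_div₀, hρc', hρc, hρa], by rw [map_mul, hTuu, ← hc']; ring⟩
    · rintro ⟨c', hρc', hc'⟩
      refine ⟨c' * (a / c), by rw [map_mul, map_div₀, hρc', hρc, hρa], ?_⟩
      have hca0 : (c / a) * Θ (c / a) ≠ 0 := mul_ne_zero (div_ne_zero hc0 ha0) ((map_ne_zero Θ).2 (div_ne_zero hc0 ha0))
      have e2 : T = T' / ((c / a) * Θ (c / a)) := by rw [hTuu, mul_div_cancel_right₀ _ hca0]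
      rw [e2, ← hc', map_mul, map_div₀, map_div₀]
      field_simp
  · -- the digit of `V′`: `V′ − V` is `Θ`-fixed and `≤ |ϖE|^{m*}`, hence `≤ |ϖE|^{2d}`
    have hΘdiff : Θ (W' / T' - V) = W' / T' - V := by rw [map_sub, map_div₀, hΘW', hΘT', hΘV]
    exact v_le_pow_two_mul_of_fixed hD hΘdiff hV'

end Summit.HodgeConjecture.HodgeConjecture.Cruxes.H413.F0P3cDyRamDiagonalCellGeneratorIndependence

end
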